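import Summits.HodgeConjecture.HodgeConjecture.Theorems.NikulinTwinTransportHodgeSimilitudeAlgebraicPrimes
import Summits.HodgeConjecture.HodgeConjecture.Theorems.NikulinTwinTransportHodgeSimilitudeAlgebraicLattice
import Summits.HodgeConjecture.HodgeConjecture.Theorems.NikulinTwinTransportHodgeSimilitudeAlgebraicAnchors

/-!
# Route NikulinTwinTransport · crux `HodgeSimilitudeAlgebraic` (stmt-HodgeConjecture-13676) —
# the crux is EQUIVALENT to "twin transport at every prime", modulo Buskin, three K3 facts and
# the composition of correspondences

Assembly of the three glue files of the crux:

* `NikulinTwinTransportHodgeSimilitudeAlgebraicPrimes` — prime multipliers suffice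
  (`hodgeSimilitudeAlgebraic_of_prime_anchors`: Buskin + composition + an algebraic anchor
  `q`-similitude for every prime `q` and every projective K3 surface ⟹ the crux);
* `NikulinTwinTransportHodgeSimilitudeAlgebraicLattice` — rational `n`-similitudes of the K3 lattice
  with rational inverse exist for every `n ≥ 1` (`exists_ratSimilitude_k3Lattice`);
* `NikulinTwinTransportHodgeSimilitudeAlgebraicAnchors` — ONE twin transport at multiplier `c`
  gives the anchors at `c` (`anchorAt_of_twinTransport`), and the crux at `c` gives every twin
  transport at `c` (`twinTransport_of_simAlgAt`).

Results:
* `anchorAt_nat_of_twinTransport`: the three K3 facts + twin transport for the rational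
  `n`-similitudes of `Λ_{K3}` ⟹ `AnchorAt[n]`, for every `n ≥ 1`.
* `hodgeSimilitudeAlgebraic_of_prime_twinTransport`: Buskin (`HodgeIsometryAlgebraic`, item
  13675) + composition of algebraic correspondences + the three K3 facts + — for every PRIME `q` —
  twin transport for the rational `q`-similitudes of the K3 lattice ⟹ `HodgeSimilitudeAlgebraic`.
* `twinTransport_of_hodgeSimilitudeAlgebraic`: conversely the crux gives twin transport for every
  rational `c`-similitude of `Λ_ℂ`, every rational `c > 0` (granted `Huybrechts_K3_hodgeTypes_H2`).
* `hodgeSimilitudeAlgebraic_iff_prime_twinTransport`: the equivalence.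

So the typed deliverable of the route's plan for this crux ("one anchor per prime — symplectic
automorphisms of order 3, 5, 7, Kummer anchors for `l`-isogenies — each transported as in
TwinTwistorTransport") is exactly `TwinTransportFor[M]` for one rational `q`-similitude `M` of the
K3 lattice, prime by prime; `q = 2` is the route's target X (via
`twinSimilitudeAlgebraic_of_twinTransport`). Nothing here proves any twin transport: each is an
open sub-case of the Hodge conjecture (Varesco 2023: known for `√2`, `√3` on the Nikulin / `σ₃`
loci only).
-/

noncomputable section

open CategoryTheory MonoidalCategory
open scoped Manifold
open Literature.AlgebraicGeometry.Motives Literature.AlgebraicGeometry.HodgeTheory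
open Literature.AlgebraicGeometry.Surfaces Literature.Geometry.Kaehler
open Literature.AlgebraicTopology.SingularHomology
open Summit.HodgeConjecture.HodgeConjecture.Theses.NikulinTwinTransport

namespace Summit.HodgeConjecture.HodgeConjecture.Theorems.NikulinTwinTransport

/-! ### Local notations (verbatim those of the three glue files) -/

/-- `MarkedK3[S, η, p, x]`: a marked K3 surface with period `x`. Local notation only, verbatim
from `NikulinTwinTransportTwinSimilitudeAlgebraicTransfer`. -/
local notation3 (prettyPrint := false) "MarkedK3[" S ", " η ", " p ", " x "]" =>
  (IsIntegralClass p ∧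
    (∀ q : complexBetti S (2 * 2), IsIntegralClass q → ∃ n : ℤ, q = n • p) ∧
    (∀ c : complexBetti S (2 * 1), IsIntegralClass c ↔ ∃ v : K3Index → ℤ, η c = fun i => (v i : ℂ)) ∧
    (∀ a b : complexBetti S (2 * 1),
        cupProduct (rfl : 2 * 1 + 2 * 1 = 2 * 2) a b = k3Form (η a) (η b) • p) ∧
    IsOfHodgeType 2 S (2 * 1) 2 0 (LinearEquiv.symm η x) ∧
    (∀ τ : complexBetti S (2 * 1), IsOfHodgeType 2 S (2 * 1) 2 0 τ → ∃ t : ℂ, τ = t • LinearEquiv.symm η x))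

/-- `PeriodPt[x]`: a projective period point. Local notation only, verbatim from the Transfer file. -/
local notation3 (prettyPrint := false) "PeriodPt[" x "]" =>
  (k3Form x x = 0 ∧ 0 < (k3Form (star x) x).re ∧
    ∃ u : K3Index → ℤ, k3Form (fun i => (u i : ℂ)) x = 0 ∧ 0 < ∑ i, ∑ j, u i * k3Gram i j * u j)

/-- `Corr[μ, S, S', hS, hS' ; γ, y] = [γ]_* y`. Local notation only, verbatim from the Transfer file. -/
local notation3 (prettyPrint := false) "Corr[" μ ", " S ", " S' ", " hS ", " hS' " ; " γ ", " y "]" =>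
  complexGysin μ
    (IsSmoothProjective.tensor_holds (IsK3Surface.isSmoothProjective hS)
      (IsK3Surface.isSmoothProjective hS'))
    (IsK3Surface.isSmoothProjective hS) (SemiCartesianMonoidalCategory.fst S S')
    (rfl : 2 * 1 + 2 * 2 + 2 * 2 = 2 * 1 + 2 * (2 + 2))
    (cupProduct (rfl : 2 * 1 + 2 * 2 = 2 * 1 + 2 * 2)
      (complexBetti.map (SemiCartesianMonoidalCategory.snd S S') (2 * 1) y) γ)

/-- `TwinTransportFor[M]`: the twin transport for the endomorphism `M` of `Λ_ℂ`. Local notation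
only, verbatim from `NikulinTwinTransportHodgeSimilitudeAlgebraicAnchors`. -/
local notation3 (prettyPrint := false) "TwinTransportFor[" M "]" =>
  ∀ (μ : OrientationFamily), μ.HasPoincareDuality →
    ∀ (S S' : SchemeOver ℂ) (hS : IsK3Surface S) (hS' : IsK3Surface S')
      (η : complexBetti S (2 * 1) ≃ₗ[ℂ] (K3Index → ℂ)) (p : complexBetti S (2 * 2))
      (x : K3Index → ℂ)
      (η' : complexBetti S' (2 * 1) ≃ₗ[ℂ] (K3Index → ℂ)) (p' : complexBetti S' (2 * 2))
      (x' : K3Index → ℂ),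
      MarkedK3[S, η, p, x] → PeriodPt[x] → MarkedK3[S', η', p', x'] → PeriodPt[x'] →
      (∃ t : ℂ, M x' = t • x) →
      ∃ γ ∈ algebraicClasses (MonoidalCategoryStruct.tensorObj S S') 2,
        ∀ y : complexBetti S' (2 * 1), η.symm (M (η' y)) = Corr[μ, S, S', hS, hS' ; γ, y]

/-- `RatTwinTransportAt[c]`: twin transport for EVERY `ℂ`-linear `c`-similitude `M` of
`(Λ_ℂ, k3Form)` defined over `ℚ` with a two-sided inverse defined over `ℚ` (such `M` exist for
every positive integer `c`, `exists_ratSimilitude_k3Lattice`). Local notation only. -/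
local notation3 (prettyPrint := false) "RatTwinTransportAt[" c "]" =>
  ∀ (M N : Module.End ℂ (K3Index → ℂ)),
    (∀ v : K3Index → ℤ, ∃ w : K3Index → ℚ, M (fun i => (v i : ℂ)) = fun i => (w i : ℂ)) →
    (∀ v : K3Index → ℤ, ∃ w : K3Index → ℚ, N (fun i => (v i : ℂ)) = fun i => (w i : ℂ)) →
    M * N = 1 → N * M = 1 → (∀ a b, k3Form (M a) (M b) = c * k3Form a b) → TwinTransportFor[M]

/-- `AnchorAt[c]`: an algebraic anchor `c`-similitude for every projective K3 surface. Local
notation only, verbatim from `NikulinTwinTransportHodgeSimilitudeAlgebraicPrimes`. -/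
local notation3 (prettyPrint := false) "AnchorAt[" c "]" =>
  ∀ (μ : OrientationFamily), μ.HasPoincareDuality →
    ∀ (S : SchemeOver ℂ)
      (hS : (IsSmoothProjective 2 S ∧ Subsingleton (structureSheafCohomology S.left 1) ∧
        ∃ (A : HodgeModel 2 S) (η : MForm 𝓘(ℝ, A.model) A.carrier ℂ 2),
          IsHolomorphicInCharts η ∧ ∀ x, η x ≠ 0))
      (p : complexBetti S (2 * 2)),
      (IsIntegralClass p ∧ ∀ q : complexBetti S (2 * 2), IsIntegralClass q → ∃ n : ℤ, q = n • p) →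
      ∃ (S'' : SchemeOver ℂ)
        (hS'' : (IsSmoothProjective 2 S'' ∧ Subsingleton (structureSheafCohomology S''.left 1) ∧
          ∃ (A : HodgeModel 2 S'') (η : MForm 𝓘(ℝ, A.model) A.carrier ℂ 2),
            IsHolomorphicInCharts η ∧ ∀ x, η x ≠ 0))
        (p'' : complexBetti S'' (2 * 2)),
        (IsIntegralClass p'' ∧
          ∀ q : complexBetti S'' (2 * 2), IsIntegralClass q → ∃ n : ℤ, q = n • p'') ∧
        ∃ Ψ : complexBetti S'' (2 * 1) ≃ₗ[ℂ] complexBetti S (2 * 1),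
          (∀ y, IsRationalClass y → IsRationalClass (Ψ.symm y)) ∧
          (∀ (i j : ℕ) y, IsOfHodgeType 2 S (2 * 1) i j y →
            IsOfHodgeType 2 S'' (2 * 1) i j (Ψ.symm y)) ∧
          (∀ (u v : complexBetti S (2 * 1)) (b : ℂ),
            cupProduct (rfl : 2 * 1 + 2 * 1 = 2 * 2) u v = (c * b) • p →
              cupProduct (rfl : 2 * 1 + 2 * 1 = 2 * 2) (Ψ.symm u) (Ψ.symm v) = b • p'') ∧
          ∃ γ ∈ algebraicClasses (MonoidalCategoryStruct.tensorObj S S'') 2,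
            ∀ x : complexBetti S'' (2 * 1),
              Ψ x = complexGysin μ (IsSmoothProjective.tensor_holds hS.1 hS''.1) hS.1
                (SemiCartesianMonoidalCategory.fst S S'')
                (rfl : 2 * 1 + 2 * 2 + 2 * 2 = 2 * 1 + 2 * (2 + 2))
                (cupProduct (rfl : 2 * 1 + 2 * 2 = 2 * 1 + 2 * 2)
                  (complexBetti.map (SemiCartesianMonoidalCategory.snd S S'') (2 * 1) x) γ)

/-- `CompCorr`: composition of algebraic correspondences between smooth projective surfaces. Local
notation only, verbatim from `NikulinTwinTransportHodgeSimilitudeAlgebraicPrimes`. -/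
local notation3 (prettyPrint := false) "CompCorr" =>
  ∀ (μ : OrientationFamily), μ.HasPoincareDuality →
    ∀ (A B C : SchemeOver ℂ) (hA : IsSmoothProjective 2 A) (hB : IsSmoothProjective 2 B)
      (hC : IsSmoothProjective 2 C),
      ∀ γ ∈ algebraicClasses (MonoidalCategoryStruct.tensorObj A B) 2,
        ∀ γ₁ ∈ algebraicClasses (MonoidalCategoryStruct.tensorObj B C) 2,
          ∃ γ₂ ∈ algebraicClasses (MonoidalCategoryStruct.tensorObj A C) 2,
            ∀ x : complexBetti C (2 * 1),
              complexGysin μ (IsSmoothProjective.tensor_holds hA hC) hA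
                  (SemiCartesianMonoidalCategory.fst A C)
                  (rfl : 2 * 1 + 2 * 2 + 2 * 2 = 2 * 1 + 2 * (2 + 2))
                  (cupProduct (rfl : 2 * 1 + 2 * 2 = 2 * 1 + 2 * 2)
                    (complexBetti.map (SemiCartesianMonoidalCategory.snd A C) (2 * 1) x) γ₂) =
                complexGysin μ (IsSmoothProjective.tensor_holds hA hB) hA
                  (SemiCartesianMonoidalCategory.fst A B)
                  (rfl : 2 * 1 + 2 * 2 + 2 * 2 = 2 * 1 + 2 * (2 + 2))
                  (cupProduct (rfl : 2 * 1 + 2 * 2 = 2 * 1 + 2 * 2)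
                    (complexBetti.map (SemiCartesianMonoidalCategory.snd A B) (2 * 1)
                      (complexGysin μ (IsSmoothProjective.tensor_holds hB hC) hB
                        (SemiCartesianMonoidalCategory.fst B C)
                        (rfl : 2 * 1 + 2 * 2 + 2 * 2 = 2 * 1 + 2 * (2 + 2))
                        (cupProduct (rfl : 2 * 1 + 2 * 2 = 2 * 1 + 2 * 2)
                          (complexBetti.map (SemiCartesianMonoidalCategory.snd B C) (2 * 1) x)
                          γ₁)))
                    γ)

/-! ### Anchors at every positive integer multiplier from twin transport -/

/-- **Anchors at multiplier `n` from twin transport at multiplier `n`** (every `n ≥ 1`): the three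
K3 facts and twin transport for the rational `n`-similitudes of the K3 lattice (which exist,
`exists_ratSimilitude_k3Lattice`) give an algebraic anchor `n`-similitude for every projective K3
surface. [folklore] -/
theorem anchorAt_nat_of_twinTransport (n : ℕ) (hn : 0 < n)
    (hP : Huybrechts_K3_periodSurjective_projective) (hMk : Huybrechts_K3_marking_exists)
    (hHT : Huybrechts_K3_hodgeTypes_H2) (htw : RatTwinTransportAt[((n : ℕ) : ℂ)]) :
    AnchorAt[((n : ℕ) : ℂ)] := by
  obtain ⟨M, N, hMrat, hNrat, hMN, hNM, hMn⟩ := exists_ratSimilitude_k3Lattice n hn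
  have h := anchorAt_of_twinTransport (n : ℚ) (by exact_mod_cast hn) hP hMk hHT M N hNrat hMN hNM
    (fun a b => by rw [Rat.cast_natCast]; exact hMn a b) (htw M N hMrat hNrat hMN hNM hMn)
  rw [Rat.cast_natCast] at h
  exact h

/-! ### The crux from twin transport at every prime, and conversely -/

/-- **`HodgeSimilitudeAlgebraic` from twin transport at every prime.** Buskin's theorem
(`HodgeIsometryAlgebraic`, item stmt-HodgeConjecture-13675), the composition of algebraic
correspondences between smooth projective surfaces, the K3 facts
`Huybrechts_K3_periodSurjective_projective`, `Huybrechts_K3_marking_exists`,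
`Huybrechts_K3_hodgeTypes_H2`, and — for every PRIME `q` — twin transport for the rational
`q`-similitudes of the K3 lattice (the twin similitude `η⁻¹ ∘ M ∘ η'` is induced by an algebraic
class on every `M`-twin pair of marked projective K3 surfaces) imply that every rational Hodge
similitude of every positive rational multiplier between projective K3 surfaces is algebraic.
(`anchorAt_nat_of_twinTransport` + `hodgeSimilitudeAlgebraic_of_prime_anchors`.)
[cite: Varesco2023, §2 (anchor + Buskin)] [cite: Buskin2019, Thm. 1.1 and §6.2] -/
theorem hodgeSimilitudeAlgebraic_of_prime_twinTransport (hB : HodgeIsometryAlgebraic)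
    (hC : CompCorr) (hP : Huybrechts_K3_periodSurjective_projective)
    (hMk : Huybrechts_K3_marking_exists) (hHT : Huybrechts_K3_hodgeTypes_H2)
    (htw : ∀ q : ℕ, q.Prime → RatTwinTransportAt[((q : ℕ) : ℂ)]) : HodgeSimilitudeAlgebraic :=
  hodgeSimilitudeAlgebraic_of_prime_anchors hB hC
    fun q hq => anchorAt_nat_of_twinTransport q hq.pos hP hMk hHT (htw q hq)

/-- **Conversely, the crux gives twin transport at every positive rational multiplier** (granted
the Hodge types of `H²(K3)`): for every rational `c > 0` and every `ℂ`-linear `c`-similitude `M`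
of `(Λ_ℂ, k3Form)` defined over `ℚ`, the twin similitude is algebraic on every `M`-twin pair.
[cite: Buskin2019, §6.2] -/
theorem twinTransport_of_hodgeSimilitudeAlgebraic (hHT : Huybrechts_K3_hodgeTypes_H2)
    (h : HodgeSimilitudeAlgebraic) (c : ℚ) (hc : 0 < c) (M : Module.End ℂ (K3Index → ℂ))
    (hMrat : ∀ v : K3Index → ℤ, ∃ w : K3Index → ℚ, M (fun i => (v i : ℂ)) = fun i => (w i : ℂ))
    (hMc : ∀ a b, k3Form (M a) (M b) = (c : ℂ) * k3Form a b) : TwinTransportFor[M] :=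
  twinTransport_of_simAlgAt c hc.ne' hHT (h c hc) M hMrat hMc

/-- **The crux `HodgeSimilitudeAlgebraic` is EQUIVALENT to twin transport at every prime**, modulo
Buskin's theorem (`HodgeIsometryAlgebraic`), the composition of algebraic correspondences and the
three K3 facts: the typed form of the route's plan "one anchor per prime, each transported as in
TwinTwistorTransport; multipliers multiply and squares are isometries, so prime multipliers
suffice". [cite: Varesco2023, §2] [cite: Buskin2019, §6.2] -/
theorem hodgeSimilitudeAlgebraic_iff_prime_twinTransport (hB : HodgeIsometryAlgebraic)
    (hC : CompCorr) (hP : Huybrechts_K3_periodSurjective_projective)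
    (hMk : Huybrechts_K3_marking_exists) (hHT : Huybrechts_K3_hodgeTypes_H2) :
    HodgeSimilitudeAlgebraic ↔ ∀ q : ℕ, q.Prime → RatTwinTransportAt[((q : ℕ) : ℂ)] := by
  constructor
  · intro h q hq M N hMrat _ _ _ hMq
    have h' := twinTransport_of_hodgeSimilitudeAlgebraic hHT h (q : ℚ) (by exact_mod_cast hq.pos) M
      hMrat (fun a b => by rw [Rat.cast_natCast]; exact hMq a b)
    exact h'
  · exact hodgeSimilitudeAlgebraic_of_prime_twinTransport hB hC hP hMk hHT

end Summit.HodgeConjecture.HodgeConjecture.Theorems.NikulinTwinTransport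

end
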